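/-
Copyright (c) 2026 the pub-hodgecm-mathlib formalisation cell (harness21).  Prover seat hodgecm-mathlib-LH4-p18 (g4), req620 Track A «(D-RAM) FOUR-FRAME» squad
(STAGE-1b, row (2) of the piece `f_{T₊}`, the (β₂) road (R-36) «PURE-CELL LEDGER»; β₂ sub-dealer LH4-p04 (g10) WORDS #32∕#37 «p18: K6-0 PER-CELL LAW» — the OFF-ROW twin on
LH4-p19 (g3)'s ★ p864098 `reads₄` socket), 2026-09-05.
-/
import Summits.HodgeConjecture.HodgeConjecture.Theorems.F0P3cDyRamConeCellPerCellLaw        -- ★ K6-0 (this seat): §1 `ncardDiff_mul_card_eq_ncard_mul_sum_of_digit_fibration` (socket-agnostic), HEAD `…reads₃`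
import Summits.HodgeConjecture.HodgeConjecture.Theorems.F0P3cDyRamConeCellCountSocketDep    -- ★ p864098 (LH4-p19 (g3)): the off-row socket frame `cellDiff_eq_zero_of_fibration_reads₄` (six-conjunct `GEN`, no `hcell`)
import HarnessLib

/-!
# Crux `H413`, line LH4 «(D-RAM) FOUR-FRAME» — STAGE-1b, row (2), the (β₂) road (R-36), K6-0 (off-row twin): «THE PER-CELL LAW OF AN OFF-ROW CONE CELL» — ★ K6-0's HEAD on ★ p864098's
# `reads₄` frame, where the depth refinement `levelSetDep ⊊ levelSet` is proper (LH4-p19 (g3)'s RAY-band cells)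

Cell `hodgecm-mathlib` (D-0151), FLOOR 0, crux item H413 = `stmt-HodgeConjecture-24833`, route of record `HCCMUnconditional`; squad F0∕P3c∕LH4; lane
`--supports stmt-HodgeConjecture-24833 --as helper` (count-neutral; pays NO tier-0 row).  THEOREMS ONLY (no `def`, no instance, no notation, no `sorry`, default heartbeats);
★-only imports; states NO law; (β₂) stays a HYPOTHESIS; every mathematical input is a HYPOTHESIS of the socket ★ p864098.
WHAT.  ★ K6-0 `…ConeCellPerCellLaw.cellDiff_mul_card_eq_cellCount_mul_sum_of_fibration_reads₃` sits on ★ p863833's row-cell frame (`hcell : levelSetDep = levelSet`).  On the OFF-ROW cells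
of the upper line the depth clause `μ·Λ^♯ ⊆ Λ` is a genuine condition (★ p864098's WHY), so — exactly as ★ p864098 does for the balance socket — THIS FILE restates the per-cell law with
the depth clause as the SIXTH conjunct of the generator data in every letter and NO `hcell`: `X(cell) · #(Rd.filter LIT) = n(cell) · Σ_{V ∈ (Rd.filter LIT).filter NX} (ψ V ? 1 : −1)`,
`cell = levelSetDep ρ Θ α (jEϖ) h j b (lam − jE u)`, `n = Σᶠ_{cell} f` (weighted), `X = Σᶠ_{cell ∩ {P₁}} f − Σᶠ_{cell ∩ {Q₁}} f` (the letters' currency).  Proof = ★ K6-0 §2's over the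
six-conjunct `GEN` (★ K6-0 §1 is socket-agnostic; ★ `…FaceTubeAbove` two-valued weight at `d ≤ b`; ★ DEFS `mem_levelSetDep_iff` on the nose).
WHAT IS NOT CLAIMED: digit-range bookkeeping, character-sum values, (hI), any census identity; the RAY-band letters stay OPEN.
HONEST LABEL.  Count-neutral bookkeeping; nothing printed is asserted; no census law is stated; `HC_CM` is proved only modulo the 7 printed citations (2 remaining named inputs: hLiu418 =
`stmt-HodgeConjecture-24832`, h413 = `stmt-HodgeConjecture-24833`) until rung 0 closes.
## References
* [Kottwitz1986BaseChangeUnits] R. E. Kottwitz, *Base change for unit elements of Hecke algebras*, Compositio Math. 60 (1986): §1 pp. 240–241 (fixed-lattice counts as orbital integrals).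
* [LabesseLanglands1979] J.-P. Labesse, R. P. Langlands, *L-indistinguishability for SL(2)*, Canad. J. Math. 31 (1979): §2 (2.2) p. 9 (κ-signed counts).
* [Rogawski1990] J. D. Rogawski, *Automorphic Representations of Unitary Groups in Three Variables*, Ann. of Math. Stud. 123 (1990): §4.9 Prop. 4.9.1 (b) p. 55 (the labelled census of `f_{T₊}`).
-/

set_option autoImplicit false

noncomputable section

namespace Summit.HodgeConjecture.HodgeConjecture.Cruxes.H413.F0P3cDyRamConeCellPerCellLawDep

open scoped Valued WithZero Matrix MatrixGroups Classical
open WithZero Finset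
open Literature.NumberTheory.Automorphic Literature.NumberTheory.Automorphic.HermitianLattice Literature.NumberTheory.Automorphic.UnitaryLatticeTree
open Literature.NumberTheory.Automorphic.UnitaryThreeFourFrame (IsRamifiedQuadraticDatum)
open Summit.HodgeConjecture.HodgeConjecture.Cruxes.H413.F0P3cDyRamToricCensusDefs
open Summit.HodgeConjecture.HodgeConjecture.Cruxes.H413.F0P3cDyRamConeCellFaceTubeAbove (finsum_levelSetDep_inter_weight_eq_two_mul_pow_mul_ncard_of_le)
open Summit.HodgeConjecture.HodgeConjecture.Cruxes.H413.F0P3cDyRamConeCellPerCellLaw (ncardDiff_mul_card_eq_ncard_mul_sum_of_digit_fibration)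

variable {E M : Type} [Field E] [Valued E ℤᵐ⁰] [Field M] [Valued M ℤᵐ⁰] {σ : E →+* E} {ρ Θ : M →+* M} {α : M}

/-! ## HEAD-Dep — the per-cell law on an OFF-ROW cell (★ p864098's `reads₄` frame: no `hcell`, the depth clause as the sixth `GEN` conjunct) -/

/-- **HEAD-Dep — «THE PER-CELL LAW OF AN OFF-ROW CONE CELL» (K6-0, `reads₄` twin).**  Frame of ★ p864098 `cellDiff_eq_zero_of_fibration_reads₄` VERBATIM MINUS `hbase` (no `hcell`;
the depth clause `μ·Λ^♯ ⊆ Λ` rides as the SIXTH conjunct of the generator data in every letter, so `levelSetDep(j, b; lam − jE u) = {Λ ∣ ∃ x₀, GEN Λ x₀}` on the nose).  THEN, in the letters'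
currency, `X(cell) · #(Rd.filter LIT) = n(cell) · Σ_{V ∈ (Rd.filter LIT).filter NX} (ψ V ? 1 : −1)` for `cell = levelSetDep ρ Θ α (jEϖ) h j b (lam − jE u)` with `levelSetDep ⊊ levelSet` allowed
(LH4-p19 (g3)'s RAY-band cells).  Same proof as §2 over the six-conjunct `GEN` (§1 is socket-agnostic).
[cite: Kottwitz1986BaseChangeUnits, §1 pp. 240–241] [cite: LabesseLanglands1979, §2 (2.2) p. 9] [cite: Rogawski1990, §4.9 Prop. 4.9.1 (b) p. 55] -/
theorem cellDiff_mul_card_eq_cellCount_mul_sum_of_fibration_reads₄ [CompleteSpace E] [IsDiscreteValuationRing 𝒪[E]] [Finite 𝓀[E]]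
    (σ : E →+* E) (hσ : ∀ a, σ (σ a) = a) (hvσ : ∀ a, Valued.v (σ a) = Valued.v a)
    {ϖ : E} (hϖ : Valued.v ϖ = WithZero.exp (-1 : ℤ)) {d t : ℕ} (hD : IsRamifiedQuadraticDatum σ ϖ d t) (h2v : Valued.v (2 : E) < 1)
    {H₂ : Matrix (Fin 2) (Fin 2) E} (hH₂σ : (H₂.map σ)ᵀ = H₂) {hW : E} (hhW : Valued.v hW = 1) (hhWσ : σ hW = hW) (jE : E →+* M)
    (hρρ : ∀ x, ρ (ρ x) = x) (hvρ : ∀ x, Valued.v (ρ x) = Valued.v x) (hα : ρ α ≠ α) (hα1 : Valued.v α ≤ 1)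
    (hint : ∀ z : M, Valued.v z ≤ 1 → Valued.v ((z - ρ z) / (α - ρ α)) ≤ 1)
    (hΘΘ : ∀ x, Θ (Θ x) = x) (hΘρ : ∀ x, Θ (ρ x) = ρ (Θ x)) (hvΘ : ∀ x, Valued.v (Θ x) = Valued.v x) (hΘj : ∀ x, Θ (jE x) = jE (σ x))
    (hjv : ∀ c, Valued.v (jE c) ≤ 1 ↔ Valued.v c ≤ 1) (hjfix : ∀ z, ρ z = z ↔ ∃ c, jE c = z)
    (hjpow : ∀ (t : E) (n : ℤ), Valued.v (jE t) = Valued.v (jE ϖ) ^ n ↔ Valued.v t = Valued.v ϖ ^ n)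
    (hϖmax : ∀ t : M, ρ t = t → Valued.v t < 1 → Valued.v t ≤ Valued.v (jE ϖ))
    (φ : (Fin 2 → E) →+ M) (hφs : ∀ (c : E) (x : Fin 2 → E), φ (c • x) = jE c * φ x) (hφi : Function.Injective φ) (hφo : Function.Surjective φ)
    {γ₂ : GL (Fin 2) E} {lam h : M} (hφγ : ∀ x, φ ((γ₂ : Matrix (Fin 2) (Fin 2) E).mulVec x) = lam * φ x) (hlam : Valued.v lam = 1)
    (hΘh : Θ h = h) (hh : h ≠ 0) (hform : ∀ x y, jE (pairing σ H₂ x y) = h * Θ (φ x) * φ y + ρ (h * Θ (φ x) * φ y))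
    (u : E) {b : ℕ} (hb : 1 ≤ b) (hdb : d ≤ b) {j : ℕ} (hlamj : IsOrd ρ α (jE ϖ ^ j) lam)
    (f : ℕ → ℕ → AddSubgroup M → ℕ)
    (hf : ∀ (b j : ℕ) (Λ : AddSubgroup M) (x₀ : M) (r : E), 1 ≤ b → x₀ ≠ 0 →
      (∀ x, x ∈ Λ ↔ ∃ z, IsOrd ρ α (jE ϖ ^ j) z ∧ x = x₀ * z) →
      IsOrd ρ α (jE ϖ ^ j) (dualGen ρ Θ α (jE ϖ ^ j) h x₀) → ¬ IsOrd ρ α (jE ϖ ^ j) (dualGen ρ Θ α (jE ϖ ^ j) h x₀ / jE ϖ) →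
      Valued.v (dualGen ρ Θ α (jE ϖ ^ j) h x₀) = Valued.v (jE ϖ) ^ b →
      (∀ b', (∀ x ∈ Λ, Valued.v (h * Θ x * b' + ρ (h * Θ x * b')) ≤ 1) → (lam - jE u) * b' ∈ Λ) →
      IsOrd ρ α (jE ϖ ^ j) lam → jE r = glueUnit ρ Θ α (jE ϖ ^ j) h (jE ϖ) (jE hW) x₀ b →
      f b j Λ = Nat.card {x : 𝒪[E] ⧸ 𝓂[E] ^ (2 * b) // ∃ u' : 𝒪[E], Ideal.Quotient.mk (𝓂[E] ^ (2 * b)) u' = x ∧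
        Valued.v ((u' : E) * σ u' - r) ≤ Valued.v (ϖ ^ (2 * b))})
    -- the cell letters
    (hjiso : ∀ a, Valued.v (jE a) = Valued.v a)
    (hfin : (levelSet ρ Θ α (jE ϖ) h j b).Finite)
    -- the fibration letters over the six-conjunct generator data
    (CLS : M → Prop) (Vf : M → M) (ε : Prop) (r : ℤᵐ⁰)
    (Rd : Finset E) (hRd2 : ∀ V : E, σ V = V → Valued.v V ≤ 1 → ∃ V₀ ∈ Rd, Valued.v (V - V₀) ≤ r)
    (hRd3 : ∀ V ∈ Rd, ∀ V' ∈ Rd, Valued.v (V - V') ≤ r → V = V')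
    (LIT NX ψ : E → Prop) [DecidablePred LIT] [DecidablePred NX] [DecidablePred ψ]
    (hI : ∀ (Λ : AddSubgroup M) (x₀ x₀' : M), (x₀ ≠ 0 ∧ (∀ x, x ∈ Λ ↔ ∃ ζ, IsOrd ρ α (jE ϖ ^ j) ζ ∧ x = x₀ * ζ) ∧
        IsOrd ρ α (jE ϖ ^ j) (dualGen ρ Θ α (jE ϖ ^ j) h x₀) ∧ ¬ IsOrd ρ α (jE ϖ ^ j) (dualGen ρ Θ α (jE ϖ ^ j) h x₀ / jE ϖ) ∧
        Valued.v (dualGen ρ Θ α (jE ϖ ^ j) h x₀) = Valued.v (jE ϖ) ^ b ∧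
        (∀ b', (∀ x ∈ Λ, Valued.v (h * Θ x * b' + ρ (h * Θ x * b')) ≤ 1) → (lam - jE u) * b' ∈ Λ)) → (x₀' ≠ 0 ∧ (∀ x, x ∈ Λ ↔ ∃ ζ, IsOrd ρ α (jE ϖ ^ j) ζ ∧ x = x₀' * ζ) ∧
        IsOrd ρ α (jE ϖ ^ j) (dualGen ρ Θ α (jE ϖ ^ j) h x₀') ∧ ¬ IsOrd ρ α (jE ϖ ^ j) (dualGen ρ Θ α (jE ϖ ^ j) h x₀' / jE ϖ) ∧
        Valued.v (dualGen ρ Θ α (jE ϖ ^ j) h x₀') = Valued.v (jE ϖ) ^ b ∧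
        (∀ b', (∀ x ∈ Λ, Valued.v (h * Θ x * b' + ρ (h * Θ x * b')) ≤ 1) → (lam - jE u) * b' ∈ Λ)) → (CLS x₀ ↔ CLS x₀') ∧ Valued.v (Vf x₀' - Vf x₀) ≤ r)
    (hV : ∀ (Λ : AddSubgroup M) (x₀ : M), (x₀ ≠ 0 ∧ (∀ x, x ∈ Λ ↔ ∃ ζ, IsOrd ρ α (jE ϖ ^ j) ζ ∧ x = x₀ * ζ) ∧
        IsOrd ρ α (jE ϖ ^ j) (dualGen ρ Θ α (jE ϖ ^ j) h x₀) ∧ ¬ IsOrd ρ α (jE ϖ ^ j) (dualGen ρ Θ α (jE ϖ ^ j) h x₀ / jE ϖ) ∧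
        Valued.v (dualGen ρ Θ α (jE ϖ ^ j) h x₀) = Valued.v (jE ϖ) ^ b ∧
        (∀ b', (∀ x ∈ Λ, Valued.v (h * Θ x * b' + ρ (h * Θ x * b')) ≤ 1) → (lam - jE u) * b' ∈ Λ)) → ∃ Ve : E, jE Ve = Vf x₀ ∧ σ Ve = Ve ∧ Valued.v Ve ≤ 1)
    (hLit : ∀ (Λ : AddSubgroup M) (x₀ : M) (V₀ : E), (x₀ ≠ 0 ∧ (∀ x, x ∈ Λ ↔ ∃ ζ, IsOrd ρ α (jE ϖ ^ j) ζ ∧ x = x₀ * ζ) ∧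
        IsOrd ρ α (jE ϖ ^ j) (dualGen ρ Θ α (jE ϖ ^ j) h x₀) ∧ ¬ IsOrd ρ α (jE ϖ ^ j) (dualGen ρ Θ α (jE ϖ ^ j) h x₀ / jE ϖ) ∧
        Valued.v (dualGen ρ Θ α (jE ϖ ^ j) h x₀) = Valued.v (jE ϖ) ^ b ∧
        (∀ b', (∀ x ∈ Λ, Valued.v (h * Θ x * b' + ρ (h * Θ x * b')) ≤ 1) → (lam - jE u) * b' ∈ Λ)) → V₀ ∈ Rd → Valued.v (Vf x₀ - jE V₀) ≤ r → LIT V₀)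
    (hNX : ∀ Ve V₀ : E, σ Ve = Ve → Valued.v Ve ≤ 1 → V₀ ∈ Rd → Valued.v (Ve - V₀) ≤ r → (NX Ve ↔ NX V₀))
    (hψ : ∀ Ve V₀ : E, σ Ve = Ve → Valued.v Ve ≤ 1 → V₀ ∈ Rd → Valued.v (Ve - V₀) ≤ r → (ψ Ve ↔ ψ V₀))
    (hF : ∀ y ∈ Rd.filter LIT, ∀ y' ∈ Rd.filter LIT,
      {Λ : AddSubgroup M | ∃ x₀, (x₀ ≠ 0 ∧ (∀ x, x ∈ Λ ↔ ∃ ζ, IsOrd ρ α (jE ϖ ^ j) ζ ∧ x = x₀ * ζ) ∧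
        IsOrd ρ α (jE ϖ ^ j) (dualGen ρ Θ α (jE ϖ ^ j) h x₀) ∧ ¬ IsOrd ρ α (jE ϖ ^ j) (dualGen ρ Θ α (jE ϖ ^ j) h x₀ / jE ϖ) ∧
        Valued.v (dualGen ρ Θ α (jE ϖ ^ j) h x₀) = Valued.v (jE ϖ) ^ b ∧
        (∀ b', (∀ x ∈ Λ, Valued.v (h * Θ x * b' + ρ (h * Θ x * b')) ≤ 1) → (lam - jE u) * b' ∈ Λ)) ∧ (CLS x₀ ↔ ε) ∧ Valued.v (Vf x₀ - jE y) ≤ r}.ncard =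
        {Λ : AddSubgroup M | ∃ x₀, (x₀ ≠ 0 ∧ (∀ x, x ∈ Λ ↔ ∃ ζ, IsOrd ρ α (jE ϖ ^ j) ζ ∧ x = x₀ * ζ) ∧
        IsOrd ρ α (jE ϖ ^ j) (dualGen ρ Θ α (jE ϖ ^ j) h x₀) ∧ ¬ IsOrd ρ α (jE ϖ ^ j) (dualGen ρ Θ α (jE ϖ ^ j) h x₀ / jE ϖ) ∧
        Valued.v (dualGen ρ Θ α (jE ϖ ^ j) h x₀) = Valued.v (jE ϖ) ^ b ∧
        (∀ b', (∀ x ∈ Λ, Valued.v (h * Θ x * b' + ρ (h * Θ x * b')) ≤ 1) → (lam - jE u) * b' ∈ Λ)) ∧ (CLS x₀ ↔ ε) ∧ Valued.v (Vf x₀ - jE y') ≤ r}.ncard)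
    -- the cell predicates and the three reads
    (P₁ Q₁ : AddSubgroup M → Prop)
    (hP : ∀ (Λ : AddSubgroup M) (x₀ : M), (x₀ ≠ 0 ∧ (∀ x, x ∈ Λ ↔ ∃ ζ, IsOrd ρ α (jE ϖ ^ j) ζ ∧ x = x₀ * ζ) ∧
        IsOrd ρ α (jE ϖ ^ j) (dualGen ρ Θ α (jE ϖ ^ j) h x₀) ∧ ¬ IsOrd ρ α (jE ϖ ^ j) (dualGen ρ Θ α (jE ϖ ^ j) h x₀ / jE ϖ) ∧
        Valued.v (dualGen ρ Θ α (jE ϖ ^ j) h x₀) = Valued.v (jE ϖ) ^ b ∧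
        (∀ b', (∀ x ∈ Λ, Valued.v (h * Θ x * b' + ρ (h * Θ x * b')) ≤ 1) → (lam - jE u) * b' ∈ Λ)) → (f b j Λ ≠ 0 ↔ (CLS x₀ ↔ ε)))
    (hL₁ : ∀ (Λ : AddSubgroup M) (x₀ : M), (x₀ ≠ 0 ∧ (∀ x, x ∈ Λ ↔ ∃ ζ, IsOrd ρ α (jE ϖ ^ j) ζ ∧ x = x₀ * ζ) ∧
        IsOrd ρ α (jE ϖ ^ j) (dualGen ρ Θ α (jE ϖ ^ j) h x₀) ∧ ¬ IsOrd ρ α (jE ϖ ^ j) (dualGen ρ Θ α (jE ϖ ^ j) h x₀ / jE ϖ) ∧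
        Valued.v (dualGen ρ Θ α (jE ϖ ^ j) h x₀) = Valued.v (jE ϖ) ^ b ∧
        (∀ b', (∀ x ∈ Λ, Valued.v (h * Θ x * b' + ρ (h * Θ x * b')) ≤ 1) → (lam - jE u) * b' ∈ Λ)) → f b j Λ ≠ 0 → (P₁ Λ ↔ ∃ Ve : E, jE Ve = Vf x₀ ∧ NX Ve ∧ ψ Ve))
    (hL₂ : ∀ (Λ : AddSubgroup M) (x₀ : M), (x₀ ≠ 0 ∧ (∀ x, x ∈ Λ ↔ ∃ ζ, IsOrd ρ α (jE ϖ ^ j) ζ ∧ x = x₀ * ζ) ∧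
        IsOrd ρ α (jE ϖ ^ j) (dualGen ρ Θ α (jE ϖ ^ j) h x₀) ∧ ¬ IsOrd ρ α (jE ϖ ^ j) (dualGen ρ Θ α (jE ϖ ^ j) h x₀ / jE ϖ) ∧
        Valued.v (dualGen ρ Θ α (jE ϖ ^ j) h x₀) = Valued.v (jE ϖ) ^ b ∧
        (∀ b', (∀ x ∈ Λ, Valued.v (h * Θ x * b' + ρ (h * Θ x * b')) ≤ 1) → (lam - jE u) * b' ∈ Λ)) → f b j Λ ≠ 0 → (Q₁ Λ ↔ ∃ Ve : E, jE Ve = Vf x₀ ∧ NX Ve ∧ ¬ ψ Ve)) :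
    (((∑ᶠ Λ ∈ levelSetDep ρ Θ α (jE ϖ) h j b (lam - jE u) ∩ {Λ | P₁ Λ}, f b j Λ : ℕ) : ℤ) -
        ((∑ᶠ Λ ∈ levelSetDep ρ Θ α (jE ϖ) h j b (lam - jE u) ∩ {Λ | Q₁ Λ}, f b j Λ : ℕ) : ℤ)) * ((Rd.filter LIT).card : ℤ) =
      ((∑ᶠ Λ ∈ levelSetDep ρ Θ α (jE ϖ) h j b (lam - jE u), f b j Λ : ℕ) : ℤ) * ∑ V ∈ (Rd.filter LIT).filter NX, (if ψ V then (1 : ℤ) else -1) := by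
  -- the three weighted counts are `2q^b ·` the populated labelled counts (★ `…FaceTubeAbove`)
  have hw := finsum_levelSetDep_inter_weight_eq_two_mul_pow_mul_ncard_of_le σ hσ hvσ hϖ hD h2v hH₂σ hhW hhWσ jE hρρ hvρ hα hα1 hint hΘΘ hΘρ hvΘ hΘj hjv hjfix hjpow hϖmax
    φ hφs hφi hφo hφγ hlam hΘh hh hform u hb hdb hlamj f hf
  have hall : ∑ᶠ Λ ∈ levelSetDep ρ Θ α (jE ϖ) h j b (lam - jE u), f b j Λ = ∑ᶠ Λ ∈ levelSetDep ρ Θ α (jE ϖ) h j b (lam - jE u) ∩ {Λ | True}, f b j Λ := by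
    rw [show ({Λ | True} : Set (AddSubgroup M)) = Set.univ from Set.setOf_true, Set.inter_univ]
  rw [hall, hw P₁, hw Q₁, hw (fun _ => True)]
  -- the populated labelled parts are §1's sets over the six-conjunct generator data (★ DEFS `mem_levelSetDep_iff` on the nose; as in ★ p864098)
  have hsep : ∀ (P : AddSubgroup M → Prop) (φ' : E → Prop),
      (∀ (Λ : AddSubgroup M) (x₀ : M), (x₀ ≠ 0 ∧ (∀ x, x ∈ Λ ↔ ∃ ζ, IsOrd ρ α (jE ϖ ^ j) ζ ∧ x = x₀ * ζ) ∧
        IsOrd ρ α (jE ϖ ^ j) (dualGen ρ Θ α (jE ϖ ^ j) h x₀) ∧ ¬ IsOrd ρ α (jE ϖ ^ j) (dualGen ρ Θ α (jE ϖ ^ j) h x₀ / jE ϖ) ∧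
        Valued.v (dualGen ρ Θ α (jE ϖ ^ j) h x₀) = Valued.v (jE ϖ) ^ b ∧
        (∀ b', (∀ x ∈ Λ, Valued.v (h * Θ x * b' + ρ (h * Θ x * b')) ≤ 1) → (lam - jE u) * b' ∈ Λ)) → f b j Λ ≠ 0 → (P Λ ↔ ∃ Ve : E, jE Ve = Vf x₀ ∧ φ' Ve)) →
      {Λ ∈ levelSetDep ρ Θ α (jE ϖ) h j b (lam - jE u) | P Λ ∧ f b j Λ ≠ 0} =
        {Λ : AddSubgroup M | ∃ x₀ : M, (x₀ ≠ 0 ∧ (∀ x, x ∈ Λ ↔ ∃ ζ, IsOrd ρ α (jE ϖ ^ j) ζ ∧ x = x₀ * ζ) ∧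
        IsOrd ρ α (jE ϖ ^ j) (dualGen ρ Θ α (jE ϖ ^ j) h x₀) ∧ ¬ IsOrd ρ α (jE ϖ ^ j) (dualGen ρ Θ α (jE ϖ ^ j) h x₀ / jE ϖ) ∧
        Valued.v (dualGen ρ Θ α (jE ϖ ^ j) h x₀) = Valued.v (jE ϖ) ^ b ∧
        (∀ b', (∀ x ∈ Λ, Valued.v (h * Θ x * b' + ρ (h * Θ x * b')) ≤ 1) → (lam - jE u) * b' ∈ Λ)) ∧ (CLS x₀ ↔ ε) ∧ ∃ Ve : E, jE Ve = Vf x₀ ∧ φ' Ve} := by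
    intro P φ' hL
    ext Λ
    rw [Set.mem_sep_iff, mem_levelSetDep_iff, mem_levelSet_iff, Set.mem_setOf_eq]
    constructor
    · rintro ⟨⟨⟨x₀, hx₀, hΛ, hyO, hyp, hylev⟩, hdep⟩, hPΛ, hw0⟩
      have hG : (x₀ ≠ 0 ∧ (∀ x, x ∈ Λ ↔ ∃ ζ, IsOrd ρ α (jE ϖ ^ j) ζ ∧ x = x₀ * ζ) ∧
        IsOrd ρ α (jE ϖ ^ j) (dualGen ρ Θ α (jE ϖ ^ j) h x₀) ∧ ¬ IsOrd ρ α (jE ϖ ^ j) (dualGen ρ Θ α (jE ϖ ^ j) h x₀ / jE ϖ) ∧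
        Valued.v (dualGen ρ Θ α (jE ϖ ^ j) h x₀) = Valued.v (jE ϖ) ^ b ∧
        (∀ b', (∀ x ∈ Λ, Valued.v (h * Θ x * b' + ρ (h * Θ x * b')) ≤ 1) → (lam - jE u) * b' ∈ Λ)) := ⟨hx₀, hΛ, hyO, hyp, hylev, hdep⟩
      exact ⟨x₀, hG, (hP Λ x₀ hG).1 hw0, (hL Λ x₀ hG hw0).1 hPΛ⟩
    · rintro ⟨x₀, hG, hC, hVe⟩
      have hw0 : f b j Λ ≠ 0 := (hP Λ x₀ hG).2 hC
      obtain ⟨hx₀, hΛ, hyO, hyp, hylev, hdep⟩ := hG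
      exact ⟨⟨⟨x₀, hx₀, hΛ, hyO, hyp, hylev⟩, hdep⟩, (hL Λ x₀ ⟨hx₀, hΛ, hyO, hyp, hylev, hdep⟩ hw0).2 hVe, hw0⟩
  have hpopS : {Λ ∈ levelSetDep ρ Θ α (jE ϖ) h j b (lam - jE u) | True ∧ f b j Λ ≠ 0} =
      {Λ : AddSubgroup M | ∃ x₀ : M, (x₀ ≠ 0 ∧ (∀ x, x ∈ Λ ↔ ∃ ζ, IsOrd ρ α (jE ϖ ^ j) ζ ∧ x = x₀ * ζ) ∧
        IsOrd ρ α (jE ϖ ^ j) (dualGen ρ Θ α (jE ϖ ^ j) h x₀) ∧ ¬ IsOrd ρ α (jE ϖ ^ j) (dualGen ρ Θ α (jE ϖ ^ j) h x₀ / jE ϖ) ∧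
        Valued.v (dualGen ρ Θ α (jE ϖ ^ j) h x₀) = Valued.v (jE ϖ) ^ b ∧
        (∀ b', (∀ x ∈ Λ, Valued.v (h * Θ x * b' + ρ (h * Θ x * b')) ≤ 1) → (lam - jE u) * b' ∈ Λ)) ∧ (CLS x₀ ↔ ε)} := by
    ext Λ
    rw [Set.mem_sep_iff, mem_levelSetDep_iff, mem_levelSet_iff, Set.mem_setOf_eq, true_and]
    constructor
    · rintro ⟨⟨⟨x₀, hx₀, hΛ, hyO, hyp, hylev⟩, hdep⟩, hw0⟩
      exact ⟨x₀, ⟨hx₀, hΛ, hyO, hyp, hylev, hdep⟩, (hP Λ x₀ ⟨hx₀, hΛ, hyO, hyp, hylev, hdep⟩).1 hw0⟩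
    · rintro ⟨x₀, hG, hC⟩
      have hw0 : f b j Λ ≠ 0 := (hP Λ x₀ hG).2 hC
      obtain ⟨hx₀, hΛ, hyO, hyp, hylev, hdep⟩ := hG
      exact ⟨⟨⟨x₀, hx₀, hΛ, hyO, hyp, hylev⟩, hdep⟩, hw0⟩
  -- finiteness of the six-conjunct family: a subfamily of `levelSet(j, b)`
  have hfin' : {Λ : AddSubgroup M | ∃ x₀ : M, (x₀ ≠ 0 ∧ (∀ x, x ∈ Λ ↔ ∃ ζ, IsOrd ρ α (jE ϖ ^ j) ζ ∧ x = x₀ * ζ) ∧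
        IsOrd ρ α (jE ϖ ^ j) (dualGen ρ Θ α (jE ϖ ^ j) h x₀) ∧ ¬ IsOrd ρ α (jE ϖ ^ j) (dualGen ρ Θ α (jE ϖ ^ j) h x₀ / jE ϖ) ∧
        Valued.v (dualGen ρ Θ α (jE ϖ ^ j) h x₀) = Valued.v (jE ϖ) ^ b ∧
        (∀ b', (∀ x ∈ Λ, Valued.v (h * Θ x * b' + ρ (h * Θ x * b')) ≤ 1) → (lam - jE u) * b' ∈ Λ))}.Finite := by
    refine hfin.subset ?_
    rintro Λ ⟨x₀, hx₀, hΛ, hyO, hyp, hylev, -⟩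
    exact (mem_levelSet_iff ρ Θ α (jE ϖ) h j b Λ).2 ⟨x₀, hx₀, hΛ, hyO, hyp, hylev⟩
  rw [hsep P₁ (fun V => NX V ∧ ψ V) hL₁, hsep Q₁ (fun V => NX V ∧ ¬ ψ V) hL₂, hpopS]
  have key := ncardDiff_mul_card_eq_ncard_mul_sum_of_digit_fibration (σ := σ) (X := AddSubgroup M)
    (fun (Λ : AddSubgroup M) (x₀ : M) => (x₀ ≠ 0 ∧ (∀ x, x ∈ Λ ↔ ∃ ζ, IsOrd ρ α (jE ϖ ^ j) ζ ∧ x = x₀ * ζ) ∧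
        IsOrd ρ α (jE ϖ ^ j) (dualGen ρ Θ α (jE ϖ ^ j) h x₀) ∧ ¬ IsOrd ρ α (jE ϖ ^ j) (dualGen ρ Θ α (jE ϖ ^ j) h x₀ / jE ϖ) ∧
        Valued.v (dualGen ρ Θ α (jE ϖ ^ j) h x₀) = Valued.v (jE ϖ) ^ b ∧
        (∀ b', (∀ x ∈ Λ, Valued.v (h * Θ x * b' + ρ (h * Θ x * b')) ≤ 1) → (lam - jE u) * b' ∈ Λ)))
    CLS Vf ε jE hjiso r Rd hRd2 hRd3 LIT NX ψ hI hV hLit hNX hψ hF hfin'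
  push_cast
  linear_combination (2 * (Nat.card 𝓀[E] : ℤ) ^ b) * key

end Summit.HodgeConjecture.HodgeConjecture.Cruxes.H413.F0P3cDyRamConeCellPerCellLawDep

end
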